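import Mathlib.Probability.ProbabilityMassFunction.Constructions
import Mathlib.Probability.Moments.SubGaussian
import HarnessLib

/-!
# McDiarmid's bounded-differences inequality on a finite product space (weighted form)

Topic `Literature/Probability/Moments`; companion of `HoeffdingCounting.lean` (Hoeffding for sums,
counting form), `Literature/Computability/Complexity/MedianOfMeans.lean` (Hoeffding for sums with
arbitrary outcome weights) and `CoordinateAveraging.lean` (the UNIFORM averaging operators `E_S`).
Here: independent coordinates with ARBITRARY per-coordinate weights, and an arbitrary function of
all coordinates with bounded differences — McDiarmid 1989:

> **Theorem (McDiarmid's inequality).** If `f` satisfies the bounded difference property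
> `sup_x f(x₁,…,x_{i−1},x,x_{i+1},…,x_n) − inf_x f(x₁,…,x_{i−1},x,x_{i+1},…,x_n) ≤ c_i` for all `i`
> and all `x₁,…,x_{i−1},x_{i+1},…,x_n`, and `X₁,…,X_n` are independent random variables, then
> for all `t > 0`, `P[|f(Xⁿ) − E f(Xⁿ)| ≥ t] ≤ 2 exp(−2t²/Σ_{k=1}^n c_k²)`.

(quoted from the survey [RaginskySason2015, Theorem 3 with eq. (4)]; the original is
[McDiarmid1989, Lemma (1.2)]).  "The strategy of the proof is similar to the one used to derive the
Azuma–Hoeffding inequality": Doob martingale of `f` along the coordinates, Hoeffding's lemma for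
each increment conditionally on the revealed coordinates, Chernoff.  This file proves exactly that,
in finite weighted language (no measure theory in the STATEMENTS):

* the sample space is `ι → Γ` (finitely many coordinates `ι`, finite alphabet `Γ`), coordinate `i`
  carries probability weights `w i : Γ → ℝ` (`≥ 0`, sum `1`), a point `y` the product weight
  `prodWeight w y = ∏_i w i (y i)`; `E[·]` is `Σ_y prodWeight w y · (·)`;
* `wCoordAvg w S F` — the conditional expectation of `F` given the coordinates OUTSIDE `S`
  (average over fresh independent values of the coordinates in `S`), written without
  normalising constants as `Σ_z prodWeight w z · F (S.piecewise z y)`; `wCoordAvg w univ F = E F`,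
  `wCoordAvg w ∅ F = F`, and the one-step law `Σ_a w k a · wCoordAvg w S F (y[k ↦ a]) =
  wCoordAvg w (insert k S) F y` (`sum_mul_wCoordAvg_update`) — the Doob martingale property;
* `hoeffding_lemma_weighted_Icc` — Hoeffding's lemma with the SHARP constant,
  `Σ_a v a · e^{λ D a} ≤ e^{λ²c²/8}` for `v`-mean-zero `D` with values in an interval of length `c`
  (bridged from Mathlib's `ProbabilityTheory.hasSubgaussianMGF_of_mem_Icc_of_integral_eq_zero`
  under `PMF.toMeasure`);
* `sum_prodWeight_mul_exp_wCoordAvg_le` — the peeling induction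
  `E exp(λ (E[F | coordinates in T] − E F)) ≤ exp(λ² Σ_{i ∈ T} c_i²/8)`;
* **McDiarmid's inequality**: one-sided `mcdiarmid_upper` / `mcdiarmid_lower`
  (`mass{±(F − E F) ≥ t} ≤ exp(−2t²/Σ c_i²)`) and two-sided `mcdiarmid_abs` (`≤ 2 exp(…)`), the
  bounded-difference hypothesis being `∀ y i a b, F (y[i ↦ a]) − F (y[i ↦ b]) ≤ c i` (= the
  displayed `sup − inf ≤ c_i`).

No named facts; everything stated is proved.

## References
* [McDiarmid1989] C. McDiarmid, *On the method of bounded differences*, in: Surveys in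
  Combinatorics 1989, LMS Lecture Note Ser. 141, CUP, 148–188 — Lemma (1.2) (the inequality) and
  its martingale proof.
* [RaginskySason2015] M. Raginsky, I. Sason, *Concentration of Measure Inequalities and Their
  Communication and Information-Theoretic Applications*, arXiv:1510.02947 — §2, eq. (4) (bounded
  differences) and Theorem 3 (McDiarmid's inequality), held text p. 5–6.
* [Hoeffding1963] W. Hoeffding, JASA 58 (1963) 13–30 — §4, proof of Thm. 2, eq. (4.16)
  (Hoeffding's lemma).
* Mathlib: `ProbabilityTheory.hasSubgaussianMGF_of_mem_Icc_of_integral_eq_zero`, `PMF.toMeasure`.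
-/

noncomputable section

namespace Literature.Probability.Moments

open _root_.MeasureTheory _root_.ProbabilityTheory Finset Real

/-! ### Hoeffding's lemma, sharp constant, finite weighted form -/

/-- **Hoeffding's lemma** (sharp constant), finite weighted form: for probability weights `v` on a
finite `Γ` and `D : Γ → ℝ` with `v`-mean zero and values in an interval `[lo, lo + c]`,
`Σ_a v(a) e^{λ D(a)} ≤ e^{λ²c²/8}`. [cite: Hoeffding1963, §4 (proof of Thm. 2, eq. (4.16))];
[cite: RaginskySason2015, §2 ("by Hoeffding's lemma", proof of the Azuma–Hoeffding inequality)] -/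
theorem hoeffding_lemma_weighted_Icc {Γ : Type*} [Fintype Γ] (v : Γ → ℝ) (hv0 : ∀ a, 0 ≤ v a)
    (hv1 : ∑ a, v a = 1) (D : Γ → ℝ) {lo c : ℝ} (hD : ∀ a, D a ∈ Set.Icc lo (lo + c))
    (hmean : ∑ a, v a * D a = 0) (l : ℝ) :
    ∑ a, v a * exp (l * D a) ≤ exp (l ^ 2 * c ^ 2 / 8) := by
  classical
  letI : MeasurableSpace Γ := ⊤
  haveI : MeasurableSingletonClass Γ := ⟨fun _ => MeasurableSpace.measurableSet_top⟩
  have hsum : ∑ a, ENNReal.ofReal (v a) = 1 := by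
    rw [← ENNReal.ofReal_sum_of_nonneg (fun a _ => hv0 a), hv1, ENNReal.ofReal_one]
  set p : PMF Γ := PMF.ofFintype (fun a => ENNReal.ofReal (v a)) hsum with hp
  set μ : Measure Γ := p.toMeasure with hμ
  have hμa : ∀ a : Γ, μ {a} = ENNReal.ofReal (v a) := fun a => by
    rw [hμ, p.toMeasure_apply_singleton a (measurableSet_singleton a), hp, PMF.ofFintype_apply]
  have hsing : ∀ a : Γ, μ.real {a} = v a := fun a => by
    rw [measureReal_def, hμa, ENNReal.toReal_ofReal (hv0 a)]
  have hint : ∀ g : Γ → ℝ, ∫ a, g a ∂μ = ∑ a, v a * g a := by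
    intro g
    rw [integral_fintype Integrable.of_finite]
    simp only [hsing, smul_eq_mul]
  have hDmeas : Measurable D := measurable_of_finite D
  have hDbdd : ∀ᵐ a ∂μ, D a ∈ Set.Icc lo (lo + c) := ae_of_all _ hD
  have hc0 : μ[D] = 0 := by rw [hint]; exact hmean
  have hsg := hasSubgaussianMGF_of_mem_Icc_of_integral_eq_zero hDmeas.aemeasurable hDbdd hc0
  have h := hsg.mgf_le l
  simp only [mgf] at h
  rw [hint] at h
  refine h.trans (le_of_eq ?_)
  congr 1
  have habs : ((‖lo + c - lo‖₊ / 2 : NNReal) : ℝ) = |c| / 2 := by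
    rw [NNReal.coe_div, coe_nnnorm, Real.norm_eq_abs, add_sub_cancel_left]; norm_num
  rw [NNReal.coe_pow, habs, div_pow, sq_abs]
  ring

variable {ι Γ : Type*} [Fintype ι] [DecidableEq ι] [Fintype Γ]

/-! ### Product weights -/

omit [DecidableEq ι] [Fintype Γ] in
/-- The product weight `W(y) = ∏_i w_i(y_i)` of independent coordinates with laws `w_i`.
[cite: McDiarmid1989, Lemma (1.2) ("independent random variables `X₁,…,X_n`")] -/
def prodWeight (w : ι → Γ → ℝ) (y : ι → Γ) : ℝ := ∏ i, w i (y i)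

omit [DecidableEq ι] [Fintype Γ] in
/-- `W ≥ 0`. [cite: McDiarmid1989, Lemma (1.2) (product law of the independent `X₁,…,X_n`)] -/
theorem prodWeight_nonneg {w : ι → Γ → ℝ} (hw : ∀ i a, 0 ≤ w i a) (y : ι → Γ) :
    0 ≤ prodWeight w y :=
  prod_nonneg fun i _ => hw i (y i)

/-- `Σ_y W(y) = ∏_i Σ_a w_i(a) = 1` (Fubini): the product law is a probability law.
[cite: McDiarmid1989, Lemma (1.2) (product law of the independent `X₁,…,X_n`)] -/
theorem sum_prodWeight {w : ι → Γ → ℝ} (hw1 : ∀ i, ∑ a, w i a = 1) :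
    ∑ y : ι → Γ, prodWeight w y = 1 := by
  unfold prodWeight
  rw [← Fintype.prod_sum (fun i a => w i a)]
  simp [hw1]

omit [Fintype Γ] in
/-- **Weight swap**: `W(y[k ↦ a]) · w_k(y_k) = W(y) · w_k(a)`. [folklore] -/
private theorem prodWeight_update_mul (w : ι → Γ → ℝ) (y : ι → Γ) (k : ι) (a : Γ) :
    prodWeight w (Function.update y k a) * w k (y k) = prodWeight w y * w k a := by
  unfold prodWeight
  have hfun : (fun i => w i (Function.update y k a i)) =
      Function.update (fun i => w i (y i)) k (w k a) := by
    funext i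
    by_cases h : i = k
    · subst h; simp
    · simp [h]
  rw [hfun, prod_update_of_mem (mem_univ k), ← mul_prod_erase univ (fun i => w i (y i)) (mem_univ k),
    sdiff_singleton_eq_erase]
  ring

omit [Fintype ι] [Fintype Γ] in
/-- The coordinate swap `(y, a) ↦ (y[k ↦ a], y_k)` is an involution of `(ι → Γ) × Γ`.
[folklore] -/
private theorem updateSwap_involutive (k : ι) :
    Function.Involutive (fun p : (ι → Γ) × Γ => (Function.update p.1 k p.2, p.1 k)) := by
  intro p
  ext
  · simp [Function.update_idem, Function.update_eq_self]
  · simp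

/-- **Resampling one coordinate preserves the product law**: for every `G`,
`Σ_y W(y) G(y) = Σ_y W(y) Σ_a w_k(a) G(y[k ↦ a])` (independence of coordinate `k` from the
others: the tower property `E[E[· | X^{k−1}]] = E[·]` of the martingale proof).
[cite: RaginskySason2015, §2 (Doob martingale decomposition, tower property)];
[cite: McDiarmid1989, proof of Lemma (1.2)] -/
theorem sum_prodWeight_mul_eq_sum_resample {w : ι → Γ → ℝ} (hw1 : ∀ i, ∑ a, w i a = 1) (k : ι)
    (G : (ι → Γ) → ℝ) :
    ∑ y, prodWeight w y * G y = ∑ y, prodWeight w y * ∑ a, w k a * G (Function.update y k a) := by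
  have h1 : ∑ y, prodWeight w y * ∑ a, w k a * G (Function.update y k a) =
      ∑ p : (ι → Γ) × Γ, prodWeight w p.1 * w k p.2 * G (Function.update p.1 k p.2) := by
    rw [Fintype.sum_prod_type]
    refine sum_congr rfl fun y _ => ?_
    rw [mul_sum]
    refine sum_congr rfl fun a _ => ?_
    ring
  have h2 : ∑ p : (ι → Γ) × Γ, prodWeight w p.1 * w k p.2 * G p.1 =
      ∑ p : (ι → Γ) × Γ, prodWeight w p.1 * w k p.2 * G (Function.update p.1 k p.2) := by
    refine Fintype.sum_equiv (updateSwap_involutive (Γ := Γ) k).toPerm _ _ fun p => ?_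
    simp only [Function.Involutive.coe_toPerm]
    rw [Function.update_idem, Function.update_eq_self, prodWeight_update_mul]
  have h3 : ∑ p : (ι → Γ) × Γ, prodWeight w p.1 * w k p.2 * G p.1 = ∑ y, prodWeight w y * G y := by
    rw [Fintype.sum_prod_type]
    refine sum_congr rfl fun y _ => ?_
    have : ∑ a, prodWeight w y * w k a * G y = prodWeight w y * G y * ∑ a, w k a := by
      rw [mul_sum]; exact sum_congr rfl fun a _ => by ring
    rw [this, hw1, mul_one]
  rw [h1, ← h2, h3]

/-! ### Weighted coordinate averaging (conditional expectation given the coordinates outside `S`) -/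

/-- **Weighted coordinate averaging** `E^w_S F (y) = Σ_z W(z) F(S.piecewise z y)`: the average of
`F` over fresh independent values (laws `w_i`) of the coordinates in `S`, the others kept from `y` —
the conditional expectation `E[F | (y_i)_{i ∉ S}]` of the Doob martingale construction.
[cite: McDiarmid1989, proof of Lemma (1.2) (the martingale `E[f | X₁,…,X_k]`)];
[cite: RaginskySason2015, §2 (Doob martingale decomposition)] -/
def wCoordAvg (w : ι → Γ → ℝ) (S : Finset ι) (F : (ι → Γ) → ℝ) (y : ι → Γ) : ℝ :=
  ∑ z : ι → Γ, prodWeight w z * F (S.piecewise z y)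

/-- Unfolding of `E^w_S`. [cite: McDiarmid1989, proof of Lemma (1.2) (the martingale
`E[f | X₁,…,X_k]`)] -/
theorem wCoordAvg_apply (w : ι → Γ → ℝ) (S : Finset ι) (F : (ι → Γ) → ℝ) (y : ι → Γ) :
    wCoordAvg w S F y = ∑ z : ι → Γ, prodWeight w z * F (S.piecewise z y) := rfl

/-- `E^w_univ F = E F` (a constant: nothing revealed, the martingale's starting value).
[cite: McDiarmid1989, proof of Lemma (1.2)]; [cite: RaginskySason2015, §2 (`E[f|X^0] = E f`)] -/
theorem wCoordAvg_univ (w : ι → Γ → ℝ) (F : (ι → Γ) → ℝ) (y : ι → Γ) :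
    wCoordAvg w univ F y = ∑ z : ι → Γ, prodWeight w z * F z := by
  simp [wCoordAvg, piecewise_univ]

/-- `E^w_∅ F = F` (everything revealed: the martingale's final value).
[cite: McDiarmid1989, proof of Lemma (1.2)]; [cite: RaginskySason2015, §2 (`E[f|X^n] = f`)] -/
theorem wCoordAvg_empty {w : ι → Γ → ℝ} (hw1 : ∀ i, ∑ a, w i a = 1) (F : (ι → Γ) → ℝ)
    (y : ι → Γ) : wCoordAvg w ∅ F y = F y := by
  simp only [wCoordAvg, piecewise_empty, ← sum_mul, sum_prodWeight hw1, one_mul]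

omit [Fintype ι] [Fintype Γ] in
/-- Changing an averaged-out coordinate does not change the average's argument. [folklore] -/
private theorem piecewise_update_of_mem {S : Finset ι} {k : ι} (hk : k ∈ S) (z y : ι → Γ) (a : Γ) :
    S.piecewise z (Function.update y k a) = S.piecewise z y := by
  ext j
  by_cases hj : j ∈ S
  · simp [piecewise, hj]
  · have : j ≠ k := fun h => hj (h ▸ hk)
    simp [piecewise, hj, this]

/-- `E^w_S F` does not depend on the coordinates in `S` (it is a function of the revealed
coordinates only). [cite: McDiarmid1989, proof of Lemma (1.2) (`E[f | X₁,…,X_k]` is a function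
of `X₁,…,X_k`)] -/
theorem wCoordAvg_update_of_mem (w : ι → Γ → ℝ) {S : Finset ι} {k : ι} (hk : k ∈ S)
    (F : (ι → Γ) → ℝ) (y : ι → Γ) (a : Γ) :
    wCoordAvg w S F (Function.update y k a) = wCoordAvg w S F y := by
  simp only [wCoordAvg, piecewise_update_of_mem hk]

omit [Fintype ι] [Fintype Γ] in
/-- Moving a kept coordinate's update into the fresh point: for `k ∉ S`,
`S.piecewise z (y[k ↦ a]) = (insert k S).piecewise (z[k ↦ a]) y`. [folklore] -/
private theorem piecewise_update_of_not_mem {S : Finset ι} {k : ι} (hk : k ∉ S) (z y : ι → Γ) (a : Γ) :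
    S.piecewise z (Function.update y k a) = (insert k S).piecewise (Function.update z k a) y := by
  ext j
  by_cases hjk : j = k
  · subst hjk; simp [piecewise, hk]
  · by_cases hj : j ∈ S
    · simp [piecewise, hj, hjk]
    · simp [piecewise, hj, hjk]

omit [Fintype ι] [Fintype Γ] in
/-- For `k ∉ S` the two points `S.piecewise z (y[k ↦ a])`, `S.piecewise z (y[k ↦ b])` differ only
in coordinate `k`. [folklore] -/
private theorem piecewise_update_eq_update {S : Finset ι} {k : ι} (hk : k ∉ S) (z y : ι → Γ) (a : Γ) :
    S.piecewise z (Function.update y k a) = Function.update (S.piecewise z y) k a := by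
  ext j
  by_cases hjk : j = k
  · subst hjk; simp [piecewise, hk]
  · by_cases hj : j ∈ S
    · simp [piecewise, hj, hjk]
    · simp [piecewise, hj, hjk]

/-- **One step of the Doob martingale**: averaging coordinate `k ∉ S` of `E^w_S F` gives
`E^w_{insert k S} F`: `Σ_a w_k(a) · E^w_S F (y[k ↦ a]) = E^w_{insert k S} F (y)`.
[cite: McDiarmid1989, proof of Lemma (1.2) (martingale property of `E[f | X₁,…,X_k]`)];
[cite: RaginskySason2015, §2 (Doob martingale, `ξ_k = E[f|X^k] − E[f|X^{k−1}]`)] -/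
theorem sum_mul_wCoordAvg_update {w : ι → Γ → ℝ} (hw1 : ∀ i, ∑ a, w i a = 1) {S : Finset ι}
    {k : ι} (hk : k ∉ S) (F : (ι → Γ) → ℝ) (y : ι → Γ) :
    ∑ a, w k a * wCoordAvg w S F (Function.update y k a) = wCoordAvg w (insert k S) F y := by
  have h1 : ∑ a, w k a * wCoordAvg w S F (Function.update y k a) =
      ∑ p : (ι → Γ) × Γ, prodWeight w p.1 * w k p.2 *
        F ((insert k S).piecewise (Function.update p.1 k p.2) y) := by
    rw [Fintype.sum_prod_type, sum_comm]
    refine sum_congr rfl fun a _ => ?_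
    rw [wCoordAvg, mul_sum]
    refine sum_congr rfl fun z _ => ?_
    rw [piecewise_update_of_not_mem hk]
    ring
  have h2 : ∑ p : (ι → Γ) × Γ, prodWeight w p.1 * w k p.2 * F ((insert k S).piecewise p.1 y) =
      ∑ p : (ι → Γ) × Γ, prodWeight w p.1 * w k p.2 *
        F ((insert k S).piecewise (Function.update p.1 k p.2) y) := by
    refine Fintype.sum_equiv (updateSwap_involutive (Γ := Γ) k).toPerm _ _ fun p => ?_
    simp only [Function.Involutive.coe_toPerm]
    rw [Function.update_idem, Function.update_eq_self, prodWeight_update_mul]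
  have h3 : ∑ p : (ι → Γ) × Γ, prodWeight w p.1 * w k p.2 * F ((insert k S).piecewise p.1 y) =
      wCoordAvg w (insert k S) F y := by
    rw [Fintype.sum_prod_type, wCoordAvg]
    refine sum_congr rfl fun z _ => ?_
    have : ∑ a, prodWeight w z * w k a * F ((insert k S).piecewise z y) =
        prodWeight w z * F ((insert k S).piecewise z y) * ∑ a, w k a := by
      rw [mul_sum]; exact sum_congr rfl fun a _ => by ring
    rw [this, hw1, mul_one]
  rw [h1, ← h2, h3]

/-- **Bounded differences pass to the martingale increments**: if `F(y[i ↦ a]) − F(y[i ↦ b]) ≤ c_i`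
always, then for `k ∉ S`, `E^w_S F (y[k ↦ a]) − E^w_S F (y[k ↦ b]) ≤ c_k`.
[cite: McDiarmid1989, proof of Lemma (1.2) (the martingale differences lie in intervals of
length `c_k`)]; [cite: RaginskySason2015, §2 eq. (4)] -/
theorem wCoordAvg_update_sub_le {w : ι → Γ → ℝ} (hw : ∀ i a, 0 ≤ w i a)
    (hw1 : ∀ i, ∑ a, w i a = 1) {F : (ι → Γ) → ℝ} {c : ι → ℝ}
    (hF : ∀ (y : ι → Γ) (i : ι) (a b : Γ), F (Function.update y i a) - F (Function.update y i b) ≤ c i)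
    {S : Finset ι} {k : ι} (hk : k ∉ S) (y : ι → Γ) (a b : Γ) :
    wCoordAvg w S F (Function.update y k a) - wCoordAvg w S F (Function.update y k b) ≤ c k := by
  rw [wCoordAvg, wCoordAvg, ← sum_sub_distrib]
  calc ∑ z : ι → Γ, (prodWeight w z * F (S.piecewise z (Function.update y k a)) -
        prodWeight w z * F (S.piecewise z (Function.update y k b)))
      ≤ ∑ z : ι → Γ, prodWeight w z * c k := by
        refine sum_le_sum fun z _ => ?_
        rw [← mul_sub, piecewise_update_eq_update hk, piecewise_update_eq_update hk]
        exact mul_le_mul_of_nonneg_left (hF _ k a b) (prodWeight_nonneg hw z)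
    _ = c k := by rw [← sum_mul, sum_prodWeight hw1, one_mul]

/-! ### The peeling induction and McDiarmid's inequality -/

/-- **Exponential moment of the Doob martingale** (peeling induction): for every finset `T` of
revealed coordinates, `Σ_y W(y) exp(λ (E^w_{Tᶜ} F (y) − E F)) ≤ exp(λ² (Σ_{i ∈ T} c_i²)/8)` —
each revealed coordinate contributes a factor `exp(λ²c_k²/8)` by Hoeffding's lemma applied
conditionally (`hoeffding_lemma_weighted_Icc`, mean zero by `sum_mul_wCoordAvg_update`, range of
length `c_k` by `wCoordAvg_update_sub_le`). [cite: McDiarmid1989, proof of Lemma (1.2)];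
[cite: RaginskySason2015, §2 (proof strategy of Theorem 3: "peeling off the terms `ξ_k` one by
one")] -/
theorem sum_prodWeight_mul_exp_wCoordAvg_le {w : ι → Γ → ℝ} (hw : ∀ i a, 0 ≤ w i a)
    (hw1 : ∀ i, ∑ a, w i a = 1) {F : (ι → Γ) → ℝ} {c : ι → ℝ}
    (hF : ∀ (y : ι → Γ) (i : ι) (a b : Γ), F (Function.update y i a) - F (Function.update y i b) ≤ c i)
    (l : ℝ) (T : Finset ι) :
    ∑ y : ι → Γ, prodWeight w y *
        exp (l * (wCoordAvg w Tᶜ F y - ∑ z : ι → Γ, prodWeight w z * F z))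
      ≤ exp (l ^ 2 * (∑ i ∈ T, c i ^ 2) / 8) := by
  classical
  set μ : ℝ := ∑ z : ι → Γ, prodWeight w z * F z with hμ
  induction T using Finset.induction_on with
  | empty =>
    have h0 : ∀ y : ι → Γ, wCoordAvg w (∅ : Finset ι)ᶜ F y - μ = 0 := fun y => by
      rw [compl_empty, wCoordAvg_univ, hμ, sub_self]
    simp only [h0, mul_zero, exp_zero, mul_one, sum_empty, zero_div, sum_prodWeight hw1, le_refl]
  | @insert k T hkT ih =>
    -- `S = (insert k T)ᶜ`, `k ∉ S`, `insert k S = Tᶜ`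
    set S : Finset ι := (insert k T)ᶜ with hS
    have hkS : k ∉ S := by rw [hS, mem_compl, not_not]; exact mem_insert_self k T
    have hTS : Tᶜ = insert k S := by
      ext j
      simp only [hS, mem_compl, mem_insert, not_or]
      by_cases hj : j = k
      · subst hj; simp [hkT]
      · simp [hj]
    -- resample coordinate `k`
    rw [sum_prodWeight_mul_eq_sum_resample hw1 k]
    -- pointwise in `y`: factor out `exp(λ (E_{Tᶜ} F y − μ))` and apply Hoeffding's lemma
    have hpt : ∀ y : ι → Γ,
        ∑ a, w k a * exp (l * (wCoordAvg w S F (Function.update y k a) - μ)) ≤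
          exp (l * (wCoordAvg w Tᶜ F y - μ)) * exp (l ^ 2 * c k ^ 2 / 8) := by
      intro y
      -- the increment `D a = E_S F (y[k↦a]) − E_{Tᶜ} F (y)`
      set D : Γ → ℝ := fun a => wCoordAvg w S F (Function.update y k a) - wCoordAvg w Tᶜ F y
        with hD
      have hsplit : ∀ a, exp (l * (wCoordAvg w S F (Function.update y k a) - μ)) =
          exp (l * (wCoordAvg w Tᶜ F y - μ)) * exp (l * D a) := by
        intro a; rw [← Real.exp_add]; congr 1; simp only [hD]; ring
      simp_rw [hsplit]
      have hcomm : ∑ a, w k a * (exp (l * (wCoordAvg w Tᶜ F y - μ)) * exp (l * D a)) =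
          exp (l * (wCoordAvg w Tᶜ F y - μ)) * ∑ a, w k a * exp (l * D a) := by
        rw [mul_sum]; exact sum_congr rfl fun a _ => by ring
      rw [hcomm]
      refine mul_le_mul_of_nonneg_left ?_ (exp_pos _).le
      -- mean zero
      have hmean : ∑ a, w k a * D a = 0 := by
        simp only [hD, mul_sub, sum_sub_distrib, ← sum_mul, hw1 k, one_mul]
        rw [sum_mul_wCoordAvg_update hw1 hkS, hTS, sub_self]
      -- `Γ` is nonempty since the weights of coordinate `k` sum to `1`
      haveI : Nonempty Γ := by
        by_contra hΓ
        rw [not_nonempty_iff] at hΓ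
        have := hw1 k
        rw [Fintype.sum_empty] at this
        exact zero_ne_one this
      -- range of length `c k`: `D a ∈ [m, m + c k]` with `m` the least value
      obtain ⟨a₀, -, ha₀⟩ := exists_min_image univ D univ_nonempty
      have hrange : ∀ a, D a ∈ Set.Icc (D a₀) (D a₀ + c k) := by
        intro a
        refine ⟨ha₀ a (mem_univ a), ?_⟩
        have := wCoordAvg_update_sub_le hw hw1 hF hkS y a a₀
        simp only [hD]
        linarith
      exact hoeffding_lemma_weighted_Icc (w k) (hw k) (hw1 k) D hrange hmean l
    calc ∑ y : ι → Γ, prodWeight w y *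
          ∑ a, w k a * exp (l * (wCoordAvg w S F (Function.update y k a) - μ))
        ≤ ∑ y : ι → Γ, prodWeight w y *
          (exp (l * (wCoordAvg w Tᶜ F y - μ)) * exp (l ^ 2 * c k ^ 2 / 8)) :=
          sum_le_sum fun y _ => mul_le_mul_of_nonneg_left (hpt y) (prodWeight_nonneg hw y)
      _ = (∑ y : ι → Γ, prodWeight w y * exp (l * (wCoordAvg w Tᶜ F y - μ))) *
          exp (l ^ 2 * c k ^ 2 / 8) := by
          rw [sum_mul]; exact sum_congr rfl fun y _ => by ring
      _ ≤ exp (l ^ 2 * (∑ i ∈ T, c i ^ 2) / 8) * exp (l ^ 2 * c k ^ 2 / 8) :=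
          mul_le_mul_of_nonneg_right ih (exp_pos _).le
      _ = exp (l ^ 2 * (∑ i ∈ insert k T, c i ^ 2) / 8) := by
          rw [← Real.exp_add, sum_insert hkT]; ring_nf

/-- **Exponential moment of `F − E F`**: `Σ_y W(y) exp(λ(F y − E F)) ≤ exp(λ² Σ_i c_i²/8)`.
[cite: McDiarmid1989, proof of Lemma (1.2)]; [cite: RaginskySason2015, §2 (proof of
Theorem 3)] -/
theorem sum_prodWeight_mul_exp_le {w : ι → Γ → ℝ} (hw : ∀ i a, 0 ≤ w i a)
    (hw1 : ∀ i, ∑ a, w i a = 1) {F : (ι → Γ) → ℝ} {c : ι → ℝ}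
    (hF : ∀ (y : ι → Γ) (i : ι) (a b : Γ), F (Function.update y i a) - F (Function.update y i b) ≤ c i)
    (l : ℝ) :
    ∑ y : ι → Γ, prodWeight w y * exp (l * (F y - ∑ z : ι → Γ, prodWeight w z * F z))
      ≤ exp (l ^ 2 * (∑ i, c i ^ 2) / 8) := by
  have h := sum_prodWeight_mul_exp_wCoordAvg_le hw hw1 hF l univ
  simp only [compl_univ, wCoordAvg_empty hw1] at h
  exact h

/-- **McDiarmid's inequality, upper tail**: under independent coordinates with laws `w_i` and
bounded differences `c_i`, for `t ≥ 0` the product weight of `{y : F y − E F ≥ t}` is at most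
`exp(−2t²/Σ_i c_i²)` (if `Σ c_i² = 0` the bound reads `exp 0 = 1` by `x/0 = 0`, still true).
[cite: McDiarmid1989, Lemma (1.2)]; [cite: RaginskySason2015, Theorem 3] -/
theorem mcdiarmid_upper {w : ι → Γ → ℝ} (hw : ∀ i a, 0 ≤ w i a) (hw1 : ∀ i, ∑ a, w i a = 1)
    {F : (ι → Γ) → ℝ} {c : ι → ℝ}
    (hF : ∀ (y : ι → Γ) (i : ι) (a b : Γ), F (Function.update y i a) - F (Function.update y i b) ≤ c i)
    {t : ℝ} (ht : 0 ≤ t) :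
    ∑ y ∈ univ.filter (fun y : ι → Γ => t ≤ F y - ∑ z : ι → Γ, prodWeight w z * F z),
        prodWeight w y ≤ exp (-(2 * t ^ 2 / ∑ i, c i ^ 2)) := by
  classical
  set μ : ℝ := ∑ z : ι → Γ, prodWeight w z * F z with hμ
  set C : ℝ := ∑ i, c i ^ 2 with hC
  set E := univ.filter (fun y : ι → Γ => t ≤ F y - μ) with hE
  have hW : ∀ y : ι → Γ, 0 ≤ prodWeight w y := prodWeight_nonneg hw
  rcases (sum_nonneg fun i (_ : i ∈ univ) => sq_nonneg (c i) : 0 ≤ C).eq_or_lt with hC0 | hCpos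
  · -- degenerate: bound is `exp 0 = 1 ≥` total mass
    have hC0' : C = 0 := by rw [hC, ← hC0]
    rw [hC0', div_zero, neg_zero, exp_zero]
    calc ∑ y ∈ E, prodWeight w y ≤ ∑ y, prodWeight w y :=
          sum_le_sum_of_subset_of_nonneg (filter_subset _ _) fun y _ _ => hW y
      _ = 1 := sum_prodWeight hw1
  -- Chernoff with `λ = 4t/C`
  set l : ℝ := 4 * t / C with hl
  have hl0 : 0 ≤ l := by positivity
  have h1 : (∑ y ∈ E, prodWeight w y) * exp (l * t) ≤
      ∑ y : ι → Γ, prodWeight w y * exp (l * (F y - μ)) := by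
    rw [sum_mul]
    refine (sum_le_sum fun y hy => ?_).trans
      (sum_le_sum_of_subset_of_nonneg (filter_subset _ _) fun y _ _ =>
        mul_nonneg (hW y) (exp_pos _).le)
    rw [hE, mem_filter] at hy
    exact mul_le_mul_of_nonneg_left (exp_le_exp.2 (mul_le_mul_of_nonneg_left hy.2 hl0)) (hW y)
  have h2 := sum_prodWeight_mul_exp_le hw hw1 hF l
  have h3 : ∑ y ∈ E, prodWeight w y ≤ exp (l ^ 2 * C / 8 - l * t) := by
    rw [Real.exp_sub, le_div_iff₀ (exp_pos _)]
    exact h1.trans h2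
  have h4 : l ^ 2 * C / 8 - l * t = -(2 * t ^ 2 / C) := by
    rw [hl]; field_simp; ring
  rwa [h4] at h3

/-- **McDiarmid's inequality, lower tail**: the product weight of `{y : E F − F y ≥ t}` is at most
`exp(−2t²/Σ_i c_i²)` (apply the upper tail to `−F`, which has the same bounded differences).
[cite: McDiarmid1989, Lemma (1.2)]; [cite: RaginskySason2015, Theorem 3] -/
theorem mcdiarmid_lower {w : ι → Γ → ℝ} (hw : ∀ i a, 0 ≤ w i a) (hw1 : ∀ i, ∑ a, w i a = 1)
    {F : (ι → Γ) → ℝ} {c : ι → ℝ}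
    (hF : ∀ (y : ι → Γ) (i : ι) (a b : Γ), F (Function.update y i a) - F (Function.update y i b) ≤ c i)
    {t : ℝ} (ht : 0 ≤ t) :
    ∑ y ∈ univ.filter (fun y : ι → Γ => t ≤ (∑ z : ι → Γ, prodWeight w z * F z) - F y),
        prodWeight w y ≤ exp (-(2 * t ^ 2 / ∑ i, c i ^ 2)) := by
  classical
  have hG : ∀ (y : ι → Γ) (i : ι) (a b : Γ),
      -F (Function.update y i a) - -F (Function.update y i b) ≤ c i := by
    intro y i a b
    have := hF y i b a
    linarith
  have h := mcdiarmid_upper (F := fun y => -F y) (c := c) hw hw1 hG ht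
  have hμ : ∑ z : ι → Γ, prodWeight w z * (fun y => -F y) z = -∑ z : ι → Γ, prodWeight w z * F z := by
    simp only [mul_neg, sum_neg_distrib]
  refine le_trans (le_of_eq (sum_congr ?_ fun _ _ => rfl)) h
  ext y
  simp only [mem_filter, mem_univ, true_and, hμ]
  constructor <;> intro hy <;> linarith

/-- **McDiarmid's inequality (bounded differences), two-sided, as printed**:
`P[|f(X) − E f(X)| ≥ t] ≤ 2 exp(−2t²/Σ_k c_k²)` for independent coordinates and `f` with bounded
differences `c_k` — in finite weighted form. [cite: McDiarmid1989, Lemma (1.2)];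
[cite: RaginskySason2015, Theorem 3 (eq. (4) hypothesis)] -/
theorem mcdiarmid_abs {w : ι → Γ → ℝ} (hw : ∀ i a, 0 ≤ w i a) (hw1 : ∀ i, ∑ a, w i a = 1)
    {F : (ι → Γ) → ℝ} {c : ι → ℝ}
    (hF : ∀ (y : ι → Γ) (i : ι) (a b : Γ), F (Function.update y i a) - F (Function.update y i b) ≤ c i)
    {t : ℝ} (ht : 0 ≤ t) :
    ∑ y ∈ univ.filter (fun y : ι → Γ => t ≤ |F y - ∑ z : ι → Γ, prodWeight w z * F z|),
        prodWeight w y ≤ 2 * exp (-(2 * t ^ 2 / ∑ i, c i ^ 2)) := by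
  classical
  set μ : ℝ := ∑ z : ι → Γ, prodWeight w z * F z with hμ
  set U := univ.filter (fun y : ι → Γ => t ≤ F y - μ) with hU
  set L := univ.filter (fun y : ι → Γ => t ≤ μ - F y) with hL
  have hW : ∀ y : ι → Γ, 0 ≤ prodWeight w y := prodWeight_nonneg hw
  have hsub : univ.filter (fun y : ι → Γ => t ≤ |F y - μ|) ⊆ U ∪ L := by
    intro y hy
    rw [mem_filter] at hy
    rw [mem_union, hU, hL, mem_filter, mem_filter]
    rcases le_abs'.1 hy.2 with h1 | h1
    · exact Or.inr ⟨mem_univ _, by linarith⟩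
    · exact Or.inl ⟨mem_univ _, h1⟩
  have hul : ∑ y ∈ U ∪ L, prodWeight w y ≤ ∑ y ∈ U, prodWeight w y + ∑ y ∈ L, prodWeight w y := by
    rw [← sum_union_inter]
    exact le_add_of_nonneg_right (sum_nonneg fun y _ => hW y)
  calc ∑ y ∈ univ.filter (fun y : ι → Γ => t ≤ |F y - μ|), prodWeight w y
      ≤ ∑ y ∈ U ∪ L, prodWeight w y := sum_le_sum_of_subset_of_nonneg hsub fun y _ _ => hW y
    _ ≤ ∑ y ∈ U, prodWeight w y + ∑ y ∈ L, prodWeight w y := hul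
    _ ≤ exp (-(2 * t ^ 2 / ∑ i, c i ^ 2)) + exp (-(2 * t ^ 2 / ∑ i, c i ^ 2)) :=
        add_le_add (mcdiarmid_upper hw hw1 hF ht) (mcdiarmid_lower hw hw1 hF ht)
    _ = 2 * exp (-(2 * t ^ 2 / ∑ i, c i ^ 2)) := by ring

end Literature.Probability.Moments

end
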